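import Summits.AtomisticToContinuum.BoseEinsteinCondensation.Theorems.BECClassicalWindowThermalGroundStateLimitBessel

/-!
# Route `BECClassicalWindow` — support item `ThermalGroundStateLimit` (stmt-AtomisticToContinuum-9073):
# orthonormal families of Dirichlet states with bounded kinetic energy are finite (mode counting)

Helper file for stmt-AtomisticToContinuum-9073 (`ThermalGroundStateLimit`). Second ingredient of
the ensemble form of `Tr e^{-βH} < ∞` for the Dirichlet box at fixed `N, L`: a **Weyl-type
counting bound**. If `(Ψᵢ)_{i ∈ ι}` is a finite `L²((ℝ³)^N)`-orthonormal family of Dirichlet trial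
states of `Λ_L^N` with kinetic energies `∫|∇Ψᵢ|² ≤ Λ`, then

  `#ι ≤ 2 · (2R + 1)^{3N}`,  `R = ⌊L√(2Λ)/(2π)⌋`.

Proof (momentum space on the torus of side `L`, through the periodisations `Ψᵢ^per`, which agree
with `Ψᵢ` on the cell): by Parseval `∑ₙ |ĉₙ(Ψᵢ^per)|² = L^{-3N}` and by the spectral form of
the kinetic energy `∑ₙ (2π|n|/L)² |ĉₙ(Ψᵢ^per)|² ≤ L^{-3N} Λ` (`PeriodicConfigFourier.lean`), so at
most half of the `ℓ²`-mass of each `Ψᵢ` sits on momenta with `(2π|n|/L)² > 2Λ`, all of which lie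
outside the cube `K = {|n_p| ≤ R ∀p}`; hence `L^{-3N} ≤ 2 ∑_{n ∈ K} |ĉₙ(Ψᵢ^per)|²`. Summing over
`i` and using Bessel's inequality `∑ᵢ |ĉₙ(Ψᵢ^per)|² ≤ L^{-3N}` for each of the `(2R+1)^{3N}`
momenta of `K` (`sum_sq_configFourierCoeff_le`) gives the bound.
-/

noncomputable section

namespace Summit.AtomisticToContinuum.BoseEinsteinCondensation.Theorems

open MeasureTheory Filter Set WithLp Complex UnitAddTorus
open scoped ENNReal NNReal Topology ComplexConjugate
open Literature.MathematicalPhysics.QuantumManyBody.BoseGas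
open Literature.MathematicalPhysics.QuantumManyBody

namespace ThermalGroundStateLimit

variable {N : ℕ} {L : ℝ}

/-- The periodisation of a Dirichlet trial state is normalised on the cell. [folklore] -/
theorem lintegral_cellN_sq_periodize (hL : 0 < L) (Ψ : TrialState N L) :
    ∫⁻ X in cellN N L, (‖periodize L Ψ.ψ X‖₊ : ℝ≥0∞) ^ 2 = 1 :=
  (Ψ.toPeriodic hL le_rfl).norm_eq

/-- The kinetic energy of the periodisation on the cell is at most the kinetic energy of the
Dirichlet state (in fact equal). [folklore] -/
theorem lintegral_cellN_kineticDensity_periodize_le (hL : 0 < L) (Ψ : TrialState N L) :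
    ∫⁻ X in cellN N L, kineticDensity (periodize L Ψ.ψ) X ≤ ∫⁻ X, kineticDensity Ψ.ψ X := by
  rw [← setLIntegral_congr (boxN_ae_eq_cellN N L),
    setLIntegral_congr_fun (measurableSet_boxN N L)
      (fun X hX => kineticDensity_periodize_of_mem_boxN hL Ψ.ψ hX)]
  exact setLIntegral_le_lintegral _ _

/-- **Parseval** for a periodised Dirichlet state: `∑ₙ |ĉₙ(Ψ^per)|² = L^{-3N}`. [folklore] -/
theorem tsum_sq_configFourierCoeff_periodize (hL : 0 < L) (Ψ : TrialState N L) :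
    ∑' n, (‖configFourierCoeff L (periodize L Ψ.ψ) n‖₊ : ℝ≥0∞) ^ 2 =
      ((ENNReal.ofReal L ^ 3)⁻¹) ^ N := by
  rw [tsum_sq_configFourierCoeff hL (continuous_periodize_trialState hL Ψ),
    lintegral_cellN_sq_periodize hL Ψ, mul_one]

/-- **The kinetic energy in momentum space** bounds the weighted `ℓ²`-mass of a periodised
Dirichlet state: `∑ₙ (2π|n|/L)² |ĉₙ(Ψ^per)|² ≤ L^{-3N} ∫|∇Ψ|²`. [folklore] -/
theorem tsum_sq_mul_sq_configFourierCoeff_periodize_le (hL : 0 < L) (Ψ : TrialState N L) :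
    ∑' n : Fin N × Fin 3 → ℤ, ENNReal.ofReal (∑ p, (2 * Real.pi * (n p) / L) ^ 2) *
        (‖configFourierCoeff L (periodize L Ψ.ψ) n‖₊ : ℝ≥0∞) ^ 2 ≤
      ((ENNReal.ofReal L ^ 3)⁻¹) ^ N * ∫⁻ X, kineticDensity Ψ.ψ X := by
  rw [tsum_sq_mul_sq_configFourierCoeff hL (contDiff_periodize_trialState hL Ψ)
    (isTorusPeriodic_periodize_trialState hL Ψ)]
  exact mul_le_mul' le_rfl (lintegral_cellN_kineticDensity_periodize_le hL Ψ)

/-- Bessel's inequality in `ℝ≥0∞` form: `∑ᵢ |ĉₙ(Ψᵢ^per)|² ≤ L^{-3N}` for an orthonormal family.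
[folklore] -/
theorem sum_sq_configFourierCoeff_le_ennreal (hL : 0 < L) {ι : Type*} [Fintype ι]
    (Ψ : ι → TrialState N L) (horth : ∀ i j, i ≠ j → ∫ X, conj ((Ψ i).ψ X) * (Ψ j).ψ X = 0)
    (n : Fin N × Fin 3 → ℤ) :
    ∑ i, (‖configFourierCoeff L (periodize L (Ψ i).ψ) n‖₊ : ℝ≥0∞) ^ 2 ≤
      ((ENNReal.ofReal L ^ 3)⁻¹) ^ N := by
  rw [← ofReal_inv_pow_three_pow hL N]
  simp only [coe_nnnorm_sq_eq_ofReal]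
  rw [← ENNReal.ofReal_sum_of_nonneg fun i _ => sq_nonneg _]
  exact ENNReal.ofReal_le_ofReal (sum_sq_configFourierCoeff_le hL Ψ horth n)

/-- Outside the cube `{|n_p| ≤ R}` some coordinate is `≥ R + 1` in absolute value, so the
kinetic weight is `≥ (2π(R+1)/L)²`. [folklore] -/
theorem sq_le_weight_of_not_mem_piFinset (hL : 0 < L) (R : ℕ) {n : Fin N × Fin 3 → ℤ}
    (hn : n ∉ Fintype.piFinset fun _ : Fin N × Fin 3 => Finset.Icc (-(R : ℤ)) R) :
    (2 * Real.pi * (R + 1) / L) ^ 2 ≤ ∑ p, (2 * Real.pi * (n p) / L) ^ 2 := by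
  rw [Fintype.mem_piFinset] at hn
  push Not at hn
  obtain ⟨p, hp⟩ := hn
  rw [Finset.mem_Icc, not_and_or, not_le, not_le] at hp
  have habs : (R : ℝ) + 1 ≤ |(n p : ℝ)| := by
    rcases hp with h | h
    · have h' : (n p : ℤ) ≤ -(R : ℤ) - 1 := by omega
      have h'' : ((n p : ℤ) : ℝ) ≤ -(R : ℝ) - 1 := by exact_mod_cast h'
      rw [le_abs]; right; linarith
    · have h' : (R : ℤ) + 1 ≤ n p := by omega
      have h'' : (R : ℝ) + 1 ≤ ((n p : ℤ) : ℝ) := by exact_mod_cast h'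
      exact h''.trans (le_abs_self _)
  calc (2 * Real.pi * (R + 1) / L) ^ 2 ≤ (2 * Real.pi * |(n p : ℝ)| / L) ^ 2 := by
        gcongr
    _ = (2 * Real.pi * (n p) / L) ^ 2 := by
        rw [div_pow, div_pow, mul_pow, mul_pow (2 * Real.pi), sq_abs]
    _ ≤ ∑ q, (2 * Real.pi * (n q) / L) ^ 2 :=
        Finset.single_le_sum (f := fun q => (2 * Real.pi * (n q) / L) ^ 2) (fun q _ => sq_nonneg _)
          (Finset.mem_univ p)

/-- The cube `{|n_p| ≤ R ∀ p} ⊂ ℤ^{3N}` has `(2R+1)^{3N}` points. [folklore] -/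
theorem card_piFinset_Icc (R : ℕ) :
    (Fintype.piFinset fun _ : Fin N × Fin 3 => Finset.Icc (-(R : ℤ)) R).card =
      (2 * R + 1) ^ (N * 3) := by
  rw [Fintype.card_piFinset, Finset.prod_const, Finset.card_univ, Fintype.card_prod,
    Fintype.card_fin, Fintype.card_fin, Int.card_Icc]
  congr 1
  omega

/-- Off the cube `{|n_p| ≤ R}` with `R + 1 > L√(2Λ)/(2π)` the kinetic weight exceeds `2Λ`.
[folklore] -/
theorem two_mul_lt_weight (hL : 0 < L) {Λ : ℝ} (hΛ : 0 < Λ) {R : ℕ}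
    (hR : L * Real.sqrt (2 * Λ) / (2 * Real.pi) < R + 1) {n : Fin N × Fin 3 → ℤ}
    (hn : n ∉ Fintype.piFinset fun _ : Fin N × Fin 3 => Finset.Icc (-(R : ℤ)) R) :
    2 * Λ < ∑ p, (2 * Real.pi * (n p) / L) ^ 2 := by
  refine lt_of_lt_of_le ?_ (sq_le_weight_of_not_mem_piFinset hL R hn)
  have h1 : Real.sqrt (2 * Λ) < 2 * Real.pi * (R + 1) / L := by
    rw [div_lt_iff₀ (by positivity)] at hR
    rw [lt_div_iff₀ hL]
    linarith
  have h0 : 0 ≤ Real.sqrt (2 * Λ) := Real.sqrt_nonneg _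
  calc 2 * Λ = Real.sqrt (2 * Λ) ^ 2 := (Real.sq_sqrt (by positivity)).symm
    _ < (2 * Real.pi * (R + 1) / L) ^ 2 := by
        rw [sq_lt_sq, abs_of_nonneg h0, abs_of_nonneg (h0.trans h1.le)]
        exact h1

/-- **Markov in momentum space** (abstract `ℝ≥0∞` bookkeeping): if a sequence `a` has total mass
`V < ∞`, weighted mass `∑ wₙaₙ ≤ VΛ`, and `wₙ > 2Λ` off a finite set `K`, then `V ≤ 2 ∑_{K} aₙ`.
[folklore] -/
theorem le_two_mul_sum_of_tsum_le {κ : Type*} (a : κ → ℝ≥0∞) (w : κ → ℝ) {V : ℝ≥0∞}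
    (hVtop : V ≠ ⊤) {Λ : ℝ} (hΛ : 0 < Λ) (K : Finset κ) (hP : ∑' n, a n = V)
    (hKin : ∑' n, ENNReal.ofReal (w n) * a n ≤ V * ENNReal.ofReal Λ)
    (hK : ∀ n, n ∉ K → 2 * Λ < w n) : V ≤ 2 * ∑ n ∈ K, a n := by
  classical
  -- split the mass into `K` and its complement
  have hsplit : ∑' n, a n = ∑ n ∈ K, a n + ∑' n, if n ∈ K then 0 else a n := by
    have h1 : ∀ n, a n = (if n ∈ K then a n else 0) + (if n ∈ K then 0 else a n) := by
      intro n; split_ifs <;> simp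
    rw [tsum_congr h1, ENNReal.tsum_add, tsum_eq_sum (s := K) (fun n hn => if_neg hn)]
    congr 1
    exact Finset.sum_congr rfl fun n hn => if_pos hn
  -- the tail carries weight `> 2Λ`, so `Λ · (2 · tail) ≤ Λ · V`
  have htail : ENNReal.ofReal Λ * (2 * ∑' n, (if n ∈ K then 0 else a n)) ≤
      ENNReal.ofReal Λ * V := by
    rw [← mul_assoc, ← ENNReal.tsum_mul_left, mul_comm _ V]
    refine le_trans (ENNReal.tsum_le_tsum fun n => ?_) hKin
    split_ifs with hn
    · simp
    · refine mul_le_mul' ?_ le_rfl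
      rw [← ENNReal.ofReal_ofNat, ← ENNReal.ofReal_mul hΛ.le, mul_comm]
      exact ENNReal.ofReal_le_ofReal (hK n hn).le
  have htail' : 2 * ∑' n, (if n ∈ K then 0 else a n) ≤ V :=
    (ENNReal.mul_le_mul_iff_right (ENNReal.ofReal_pos.2 hΛ).ne' ENNReal.ofReal_ne_top).1 htail
  have h2V : V + V ≤ 2 * ∑ n ∈ K, a n + V := by
    calc V + V = 2 * (∑ n ∈ K, a n + ∑' n, (if n ∈ K then 0 else a n)) := by
          rw [← hsplit, hP, two_mul]
      _ = 2 * ∑ n ∈ K, a n + 2 * ∑' n, (if n ∈ K then 0 else a n) := mul_add _ _ _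
      _ ≤ 2 * ∑ n ∈ K, a n + V := add_le_add le_rfl htail'
  exact ENNReal.le_of_add_le_add_right hVtop h2V

/-- **Double counting** (abstract `ℝ≥0∞` bookkeeping): if each of the `#ι` rows of a non-negative
array has `V ≤ 2 ∑_{n ∈ K} aᵢₙ` and each column has `∑ᵢ aᵢₙ ≤ V` (`0 < V < ∞`), then
`#ι ≤ 2 #K`. [folklore] -/
theorem card_le_two_mul_card {ι κ : Type*} [Fintype ι] (a : ι → κ → ℝ≥0∞) {V : ℝ≥0∞}
    (hV0 : V ≠ 0) (hVtop : V ≠ ⊤) (K : Finset κ) (hrow : ∀ i, V ≤ 2 * ∑ n ∈ K, a i n)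
    (hcol : ∀ n, ∑ i, a i n ≤ V) : Fintype.card ι ≤ 2 * K.card := by
  have hsum : (Fintype.card ι : ℝ≥0∞) * V ≤ (2 * K.card : ℝ≥0∞) * V := by
    calc (Fintype.card ι : ℝ≥0∞) * V = ∑ _i : ι, V := by
          rw [Finset.sum_const, Finset.card_univ, nsmul_eq_mul]
      _ ≤ ∑ i, 2 * ∑ n ∈ K, a i n := Finset.sum_le_sum fun i _ => hrow i
      _ = 2 * ∑ n ∈ K, ∑ i, a i n := by rw [← Finset.mul_sum, Finset.sum_comm]
      _ ≤ 2 * ∑ _n ∈ K, V := mul_le_mul' le_rfl (Finset.sum_le_sum fun n _ => hcol n)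
      _ = (2 * K.card : ℝ≥0∞) * V := by rw [Finset.sum_const, nsmul_eq_mul, mul_assoc]
  have hcard : (Fintype.card ι : ℝ≥0∞) ≤ (2 * K.card : ℝ≥0∞) :=
    (ENNReal.mul_le_mul_iff_left hV0 hVtop).1 hsum
  exact_mod_cast hcard

/-- **Weyl-type counting bound** (cube of half-side `R`, `R + 1 > L√(2Λ)/(2π)`): a finite
`L²((ℝ³)^N)`-orthonormal family of Dirichlet trial states of `Λ_L^N` with kinetic energies `≤ Λ`
has at most `2(2R+1)^{3N}` members. [folklore] -/
theorem card_le_of_lintegral_kineticDensity_le' (hL : 0 < L) {ι : Type*} [Fintype ι]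
    (Ψ : ι → TrialState N L) (horth : ∀ i j, i ≠ j → ∫ X, conj ((Ψ i).ψ X) * (Ψ j).ψ X = 0)
    {Λ : ℝ} (hΛ : 0 < Λ) (hkin : ∀ i, ∫⁻ X, kineticDensity (Ψ i).ψ X ≤ ENNReal.ofReal Λ) {R : ℕ}
    (hR : L * Real.sqrt (2 * Λ) / (2 * Real.pi) < R + 1) :
    Fintype.card ι ≤ 2 * (2 * R + 1) ^ (N * 3) := by
  have hL3 : (ENNReal.ofReal L ^ 3) ≠ 0 := pow_ne_zero _ (ENNReal.ofReal_pos.2 hL).ne'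
  have hV0 : ((ENNReal.ofReal L ^ 3)⁻¹) ^ N ≠ 0 :=
    pow_ne_zero _ (ENNReal.inv_ne_zero.2 (ENNReal.pow_ne_top ENNReal.ofReal_ne_top))
  have hVtop : ((ENNReal.ofReal L ^ 3)⁻¹) ^ N ≠ ⊤ := ENNReal.pow_ne_top (ENNReal.inv_ne_top.2 hL3)
  have hrow : ∀ i, ((ENNReal.ofReal L ^ 3)⁻¹) ^ N ≤
      2 * ∑ n ∈ Fintype.piFinset (fun _ : Fin N × Fin 3 => Finset.Icc (-(R : ℤ)) R),
        (‖configFourierCoeff L (periodize L (Ψ i).ψ) n‖₊ : ℝ≥0∞) ^ 2 := fun i =>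
    le_two_mul_sum_of_tsum_le (fun n => (‖configFourierCoeff L (periodize L (Ψ i).ψ) n‖₊ : ℝ≥0∞) ^ 2)
      (fun n => ∑ p, (2 * Real.pi * (n p) / L) ^ 2) hVtop hΛ _
      (tsum_sq_configFourierCoeff_periodize hL (Ψ i))
      ((tsum_sq_mul_sq_configFourierCoeff_periodize_le hL (Ψ i)).trans (mul_le_mul' le_rfl (hkin i)))
      (fun n hn => two_mul_lt_weight hL hΛ hR hn)
  have h := card_le_two_mul_card
    (fun i n => (‖configFourierCoeff L (periodize L (Ψ i).ψ) n‖₊ : ℝ≥0∞) ^ 2) hV0 hVtop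
    (Fintype.piFinset (fun _ : Fin N × Fin 3 => Finset.Icc (-(R : ℤ)) R)) hrow
    (fun n => sum_sq_configFourierCoeff_le_ennreal hL Ψ horth n)
  rwa [card_piFinset_Icc] at h

/-- **Weyl-type counting bound.** A finite `L²((ℝ³)^N)`-orthonormal family of Dirichlet trial
states of `Λ_L^N` (`L > 0`) with kinetic energies `∫|∇Ψᵢ|² ≤ Λ` (`Λ > 0`) has at most
`2 (2R+1)^{3N}` members, `R = ⌊L√(2Λ)/(2π)⌋` — the ensemble-level form of "the Dirichlet
Laplacian on `Λ_L^N` has at most polynomially many eigenvalues below `Λ`" (compact resolvent /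
Weyl law), which is what makes `Tr e^{-βH} < ∞`. [folklore] -/
theorem card_le_of_lintegral_kineticDensity_le (hL : 0 < L) {ι : Type*} [Fintype ι]
    (Ψ : ι → TrialState N L) (horth : ∀ i j, i ≠ j → ∫ X, conj ((Ψ i).ψ X) * (Ψ j).ψ X = 0)
    {Λ : ℝ} (hΛ : 0 < Λ) (hkin : ∀ i, ∫⁻ X, kineticDensity (Ψ i).ψ X ≤ ENNReal.ofReal Λ) :
    Fintype.card ι ≤ 2 * (2 * ⌊L * Real.sqrt (2 * Λ) / (2 * Real.pi)⌋₊ + 1) ^ (N * 3) :=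
  card_le_of_lintegral_kineticDensity_le' hL Ψ horth hΛ hkin (Nat.lt_floor_add_one _)

end ThermalGroundStateLimit

end Summit.AtomisticToContinuum.BoseEinsteinCondensation.Theorems

end
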